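import Literature.NumberTheory.EllipticCurves.HeegnerPointsKolyvaginStructure
import Literature.NumberTheory.EllipticCurves.BSDSelmerPConverseYanZhuKolyvaginSystemProofs
import Literature.NumberTheory.EllipticCurves.QuadraticTwistHeegnerRootNumberProofs
import Literature.NumberTheory.EllipticCurves.BSDSelmerParityDokchitserProofs
import Literature.NumberTheory.EllipticCurves.BSDSelmerParityDokchitserBaseChangeProofs
import Literature.NumberTheory.EllipticCurves.SelmerCorankHolds
import HarnessLib

/-!
# Kolyvagin's structure theorem (1991, Thm. 4): the shape of the conclusion, the depth-zero case
# from Kolyvagin's 1988 theorem, and the parity clauses from `p`-parity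

`Proofs` companion (theorems only: no definition, no new named fact) of
`Literature.NumberTheory.EllipticCurves.HeegnerPointsKolyvaginStructure` for the named fact
`Literature.NumberTheory.EllipticCurves.Kolyvagin1991_selmerCorank_of_kolyvaginClass_ne_zero`
("(K2)" below), the tree's transcription of

* V. A. Kolyvagin, *On the structure of Selmer groups*, Math. Ann. 291 (1991) 253–259, §2,
  **Theorem 4** (= Theorem 2.3 of the MPI typescript, p. 7: *"Suppose Conjecture 1.1 is true. Then
  `r^{(f+1)} = f + 1`, `r^{(f)} ≤ f`, and `f − r^{(f)}` is even"*; setting §1, typescript pp. 2–4: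
  `K = ℚ(√D)`, `0 > D ≡ □ (mod 4N)`, `D ≠ −3, −4`; `ℓ ∈ B(E)`; `f` the least depth `r` with a
  non-zero class `τ_{λ,n}`, `λ ∈ Λ^r`; p. 6: `r^ν` the `ℤ_ℓ`-corank of `S^ν`, *"the Selmer group
  of level `ℓ^n` for `E^ν` over `ℚ`. Here `E^ν` is `E` if `(−1)^{ν+1}ε = 1`, and `E^ν` is the form
  of `E` over `K` otherwise"*), restated by
* W. Zhang, *Selmer groups and the indivisibility of Heegner points*, Camb. J. Math. 2 (2014),
  **Thm. 11.2 (i)** (p. 248, "(Kolyvagin)": hypotheses `(p, DN) = 1`, `N⁻` square-free with an even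
  number of factors, `ρ̄_{E,p}` surjective, `M_∞` finite; conclusion `r_p^{ε_ν}(E/K) = ν + 1`,
  `0 ≤ ν − r_p^{−ε_ν}(E/K) ≡ 0 (mod 2)`, `ν = ord κ^∞`) and Thm. 1.2 (p. 195, (1.1):
  `ord κ^∞ = max{r_p⁺(E/K), r_p⁻(E/K)} − 1`, citing "[24, Theorem 4]").

(K2) says: at a non-zero class `c_M(n) ≠ 0` of MINIMAL depth `ν = #{ℓ ∣ n}` of the Heegner-point
Kolyvagin system of `(E, K, p)` (`p ≥ 5`, `ρ̄_{E,p}` onto, `d_K ≠ −3, −4`, `p ∤ d_K N_E`, Heegner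
hypothesis), with `c = corank_{ℤ_p} Sel_{p^∞}(E/ℚ)` and `c' = corank_{ℤ_p} Sel_{p^∞}(E^{(d_K)}/ℚ)`:
EITHER `c = ν + 1 ∧ c' ≤ ν ∧ 2 ∣ ν − c'` OR `c' = ν + 1 ∧ c ≤ ν ∧ 2 ∣ ν − c`. Checked against both
sources (this unit, 2026-08-17): a faithful WEAKENING of print (the disjunction forgets which
eigenspace is which; `p ≥ 5` with mod-`p` surjectivity gives `p ∈ B(E)` by Serre; the Heegner
hypothesis gives `D ≡ □ (mod 4N)` and `(D, N) = 1`); the citation carried by the `def` is exact.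

## What the tree can and cannot prove of (K2) — the point of this file

(K2) has no `_holds`, and none is in reach: for depth `ν ≥ 1` Kolyvagin's proof (Math. Ann. 291,
Thms. 2–3 = typescript Thms. 2.1–2.2, "essentially based on" *On the structure of
Shafarevich–Tate groups*, LNM 1479 (1991): the Euler-system relations of the classes `τ_{λ,n}`,
the Čebotarev choice of auxiliary primes (Prop. 8 there), global duality, and the Cassels pairing
for the parity statement) has no counterpart in the tree, whose Kolyvagin files
(`HeegnerPointsKolyvagin*Proofs`) formalise B. Gross's 1991 exposition of the RANK-ONE argument
only. No named fact of the tree implies (K2) at depth `≥ 1`. What the tree's Gross–Zagier /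
Kolyvagin material does give is recorded here as theorems:

1. **The shape of the conclusion** (`kolyvaginStructure_alternative_iff_max`): (K2)'s two-case
   alternative is equivalent to Zhang's symmetric form `max{c, c'} = ν + 1`, `min{c, c'} ≤ ν`,
   `2 ∣ ν − min{c, c'}` — (1.1) of Zhang's Thm. 1.2 / BCGS 2026, Cor. 1:
   `ord(κ^{Heeg}) = max{r⁺, r⁻} − 1`. Corollaries of (K2) in that form, at a minimal class
   (`Kolyvagin1991_selmerCorank_of_kolyvaginClass_ne_zero.max_selmerCorank_eq`) and at ANY non-zero
   class without the minimality hypothesis (`….max_selmerCorank_le`: `1 ≤ max{c, c'} ≤ ν(n) + 1`,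
   the form consumed by the `SelmerRankLB` theorems of the BSD summit).
2. **Depth zero is Kolyvagin's 1988 theorem** (`selmerCorank_add_eq_one_of_kolyvaginClass_one_ne_zero_of_kolyvagin`,
   `kolyvaginStructure_one_of_kolyvagin`): the body of (K2) at `n = 1` — where minimality is
   vacuous and the conclusion reads `c + c' = 1` — follows from the tree's named facts `kolyvagin`
   (Kolyvagin 1990, Thm. A / Gross 1991, Thm. 1.3: `y_K` of infinite order ⇒ `rank E(K) = 1` and
   `Ш(E/K)` finite) and `heegnerPointOfConductor_one_galoisConj` (Shimura reciprocity at conductor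
   `1`: `P(1) = Tr_{K[1]/K} y(1) = y_K`), through the PROVED corank identities
   `corank Sel_{p^∞}(E/K) = rank E(K) + corank Ш(E/K)[p^∞]` (`selmerCorank_eq_mordellWeilRank_add_holds`),
   `corank Ш[p^∞] = 0` for finite `Ш` (`shaCorank_eq_zero_of_finite`) and
   `corank Sel_{p^∞}(E/K) = c + c'` (`selmerCorank_baseChange_quadratic_holds`), and the proved
   bottom-class lemmas of `BSDSelmerPConverseYanZhuKolyvaginSystemProofs` (`c_M(1) ≠ 0 ⇒ P(1)`
   non-torsion; `P(1)` descends to a Heegner point `y_K ∈ E(K)`). This is Kolyvagin's remark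
   *"f = 0 ⟺ P_1 has infinite order"* (typescript p. 4) followed by [2] = *Euler systems*.
3. **The parity clauses are `p`-parity** (`odd_selmerCorank_add_selmerCorank_quadraticTwist_of_p_parity`,
   `kolyvaginStructure_alternative_of_rank_clauses`): under the Heegner hypothesis
   `w(E) w(E^{(d_K)}) = −1` (tree theorem
   `rootNumber_mul_rootNumber_quadraticTwist_discr_of_exists_isNewformOf`, from the Modularity
   Theorem `exists_isNewformOf`), so the `p`-parity theorem (`p_parity`, Dokchitser–Dokchitser
   2010, Thm. 1.4, a named fact) makes `c + c'` odd, and then the rank clauses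
   `c = ν + 1 ∧ c' ≤ ν` (resp. `c' = ν + 1 ∧ c ≤ ν`) already imply `2 ∣ ν − c'` (resp. `2 ∣ ν − c`).
   Kolyvagin derives the parity the other way round (Thm. 2.4: the structure theorem IMPLIES
   `r^ν ≡ g^ν (mod 2)`); in the tree's trust base the parity conjuncts of (K2) thus cost nothing
   beyond `p_parity` and `exists_isNewformOf`, both already leaves of the `p`-converse dependents
   of (K2) (`BSDSelmerPConverseYanZhuKolyvaginSystemProofs`).

So the irreducible content of (K2) missing from the tree is exactly the pair of rank clauses at
depth `ν ≥ 1`: Kolyvagin 1991, Thms. 2–3 with LNM 1479.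

## References

* [Kolyvagin1991MathAnn] V. A. Kolyvagin, *On the structure of Selmer groups*, Math. Ann. 291
  (1991) 253–259: §1 (setting, Conj. 1.1), §2 Thm. 4 (= typescript Thm. 2.3, p. 7), Thm. 2.4
  (held `paper:doi-10-1007-bf01445205`, typescript pp. 2–7).
* [WZhang2014] W. Zhang, Camb. J. Math. 2 (2014) 191–253: p. 194, Thm. 1.2 (p. 195), proof of
  Thm. 1.3 (p. 196), Thm. 11.2 (p. 248) (held `paper:doi-10-4310-cjm-2014-v2-n2-a2`).
* [BurungaleEtAl2026] A. Burungale, F. Castella, G. Grossi, C. Skinner, Camb. J. Math. 14 (2026)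
  = arXiv:2312.09301, Cor. 1 (§0.1, p. 4).
* [GrossLMS1991] B. H. Gross, *Kolyvagin's work on modular elliptic curves*, LMS LNS 153 (1991),
  Thm. 1.3, §4 (`P_1 = y_K`).
* [Kolyvagin1990] V. A. Kolyvagin, *Euler systems*, Progr. Math. 87 (1990), Thm. A.
* [DokchitserDokchitserAnnals2010] T. Dokchitser, V. Dokchitser, Ann. of Math. 172 (2010),
  Thm. 1.4.
* [Darmon2004] H. Darmon, CBMS 101 (2004), §3.6 Thm. 3.15 (sign `−1` under the Heegner hypothesis).
-/

noncomputable section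

open scoped Classical

universe u

namespace Literature.NumberTheory.EllipticCurves

open ModularForms WeierstrassCurve

/-! ### 1. The shape of the conclusion: `ord κ^∞ = max{r⁺, r⁻} − 1` -/

/-- **(K2)'s two-case alternative is Zhang's symmetric form** (W. Zhang 2014, Thm. 1.2 (1.1):
`ord κ^∞ = max{r_p⁺, r_p⁻} − 1`, with `r^{ε_ν} = ν + 1`, `0 ≤ ν − r^{−ε_ν} ≡ 0 (mod 2)`): for
natural numbers `c, c', ν`,
`(c = ν + 1 ∧ c' ≤ ν ∧ 2 ∣ ν − c') ∨ (c' = ν + 1 ∧ c ≤ ν ∧ 2 ∣ ν − c)` iff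
`max{c, c'} = ν + 1 ∧ min{c, c'} ≤ ν ∧ 2 ∣ ν − min{c, c'}` (linear arithmetic).
[cite: WZhang2014, Thm. 1.2 (1.1) (p. 195)] -/
theorem kolyvaginStructure_alternative_iff_max (c c' ν : ℕ) :
    ((c = ν + 1 ∧ c' ≤ ν ∧ Even (ν - c')) ∨ (c' = ν + 1 ∧ c ≤ ν ∧ Even (ν - c))) ↔
      (max c c' = ν + 1 ∧ min c c' ≤ ν ∧ Even (ν - min c c')) := by
  simp only [Nat.even_iff]
  omega

/-- **The parity conjuncts follow from the rank clauses once `c + c'` is odd**: if `c + c'` is odd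
and `c = ν + 1 ∧ c' ≤ ν` or `c' = ν + 1 ∧ c ≤ ν`, then the full alternative of (K2) holds
(`ν − c' = (c + c' − 1) − 2c'`). In Kolyvagin's notation: `r⁰ + r¹` odd and `r^{(f+1)} = f + 1`
give `f − r^{(f)}` even. (Linear arithmetic; the source proves the parity from the Cassels form
instead, typescript proof of Thm. 2.3.) [cite: Kolyvagin1991MathAnn, §2 Thm. 4 (proof: Cassels form on X^{(f)})] -/
theorem kolyvaginStructure_alternative_of_rank_clauses {c c' ν : ℕ} (hodd : Odd (c + c'))
    (h : (c = ν + 1 ∧ c' ≤ ν) ∨ (c' = ν + 1 ∧ c ≤ ν)) :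
    (c = ν + 1 ∧ c' ≤ ν ∧ Even (ν - c')) ∨ (c' = ν + 1 ∧ c ≤ ν ∧ Even (ν - c)) := by
  simp only [Nat.even_iff]
  rw [Nat.odd_iff] at hodd
  omega

/-- **(K2) in Zhang's form at a minimal non-zero class**: under the hypotheses of
`Kolyvagin1991_selmerCorank_of_kolyvaginClass_ne_zero` (a non-zero class `c_M(n)` whose depth
`ν(n)` is minimal among the non-zero classes of the system `(Dt, β, ι)`),
`max{c, c'} = ν(n) + 1`, `min{c, c'} ≤ ν(n)` and `2 ∣ ν(n) − min{c, c'}`, where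
`c = corank_{ℤ_p} Sel_{p^∞}(E/ℚ)`, `c' = corank_{ℤ_p} Sel_{p^∞}(E^{(d_K)}/ℚ)` — W. Zhang 2014,
Thm. 1.2 (1.1) `ord κ^∞ = max{r_p⁺, r_p⁻} − 1`; BCGS 2026, Cor. 1. CONDITIONAL on the named fact
(hypothesis `h`). [cite: WZhang2014, Thm. 1.2 (1.1) (p. 195) and Thm. 11.2 (i) (p. 248)]
[cite: Kolyvagin1991MathAnn, §2 Thm. 4] -/
theorem Kolyvagin1991_selmerCorank_of_kolyvaginClass_ne_zero.max_selmerCorank_eq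
    (h : Kolyvagin1991_selmerCorank_of_kolyvaginClass_ne_zero)
    (W : WeierstrassCurve ℚ) [W.IsElliptic] [W.IsGloballyMinimal] (p : ℕ) [hp : Fact p.Prime]
    (hp5 : 5 ≤ p) (hsurj : W.HasSurjectiveModNGaloisRep p)
    (K : Type) [Field K] [NumberField K] (hK : IsImaginaryQuadratic K)
    (h3 : NumberField.discr K ≠ -3) (h4 : NumberField.discr K ≠ -4)
    (hpd : ¬ ((p : ℤ) ∣ NumberField.discr K)) (hpN : ¬ (p ∣ W.conductorNorm ℤ))
    [NeZero (W.conductorNorm ℤ)] (hH : SatisfiesHeegnerHypothesis (W.conductorNorm ℤ) K)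
    (Dt : ModularParametrizationData W (W.conductorNorm ℤ)) (β : ℤ) (ι : K →+* ℂ) (n : ℕ)
    (d : KolyvaginHeegnerData Dt β ι n) (M : ℕ)
    (hn : KolyvaginDescent.KolSupp (Zhang2014.IsKolyvaginPrime (W.conductorNorm ℤ) W K p) n)
    (hM : 1 ≤ M) (hMle : (M : ℕ∞) ≤ Zhang2014.levelIndex W p n)
    (hne : d.kolyvaginClass hp.out M ≠ 0)
    (hmin : ∀ (n' : ℕ) (d' : KolyvaginHeegnerData Dt β ι n') (M' : ℕ),
      KolyvaginDescent.KolSupp (Zhang2014.IsKolyvaginPrime (W.conductorNorm ℤ) W K p) n' →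
      1 ≤ M' → (M' : ℕ∞) ≤ Zhang2014.levelIndex W p n' → d'.kolyvaginClass hp.out M' ≠ 0 →
      n.primeFactors.card ≤ n'.primeFactors.card) :
    max (W.selmerCorank p) ((W.quadraticTwist (NumberField.discr K : ℚ)).selmerCorank p) =
        n.primeFactors.card + 1 ∧
      min (W.selmerCorank p) ((W.quadraticTwist (NumberField.discr K : ℚ)).selmerCorank p) ≤
        n.primeFactors.card ∧
      Even (n.primeFactors.card -
        min (W.selmerCorank p) ((W.quadraticTwist (NumberField.discr K : ℚ)).selmerCorank p)) :=
  (kolyvaginStructure_alternative_iff_max _ _ _).mp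
    (h W p hp5 hsurj K hK h3 h4 hpd hpN hH Dt β ι n d M hn hM hMle hne hmin)

/-- **(K2) at ANY non-zero class, without the minimality hypothesis: `1 ≤ max{c, c'} ≤ ν(n) + 1`.**
Under the standing hypotheses of `Kolyvagin1991_selmerCorank_of_kolyvaginClass_ne_zero`, if some
class `c_M(n) ≠ 0` (`n` a square-free product of Kolyvagin primes, `1 ≤ M ≤ M(n)`), then
`max{c, c'} = ν₀ + 1` for the minimal depth `ν₀ ≤ ν(n)` of a non-zero class of the same system
(`heegnerSystem_exists_minimal_kolyvaginClass_ne_zero`, well-ordering of `ℕ`), whence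
`1 ≤ max{c, c'} ≤ ν(n) + 1` — the bound `c ≤ ν(n) + 1` used by the `SelmerRankLB` theorems of the
BSD summit. CONDITIONAL on the named fact (hypothesis `h`).
[cite: WZhang2014, Thm. 1.2 (1.1) (p. 195)] [cite: Kolyvagin1991MathAnn, §2 Thm. 4] -/
theorem Kolyvagin1991_selmerCorank_of_kolyvaginClass_ne_zero.max_selmerCorank_le
    (h : Kolyvagin1991_selmerCorank_of_kolyvaginClass_ne_zero)
    (W : WeierstrassCurve ℚ) [W.IsElliptic] [W.IsGloballyMinimal] (p : ℕ) [hp : Fact p.Prime]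
    (hp5 : 5 ≤ p) (hsurj : W.HasSurjectiveModNGaloisRep p)
    (K : Type) [Field K] [NumberField K] (hK : IsImaginaryQuadratic K)
    (h3 : NumberField.discr K ≠ -3) (h4 : NumberField.discr K ≠ -4)
    (hpd : ¬ ((p : ℤ) ∣ NumberField.discr K)) (hpN : ¬ (p ∣ W.conductorNorm ℤ))
    [NeZero (W.conductorNorm ℤ)] (hH : SatisfiesHeegnerHypothesis (W.conductorNorm ℤ) K)
    (Dt : ModularParametrizationData W (W.conductorNorm ℤ)) (β : ℤ) (ι : K →+* ℂ) (n : ℕ)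
    (d : KolyvaginHeegnerData Dt β ι n) (M : ℕ)
    (hn : KolyvaginDescent.KolSupp (Zhang2014.IsKolyvaginPrime (W.conductorNorm ℤ) W K p) n)
    (hM : 1 ≤ M) (hMle : (M : ℕ∞) ≤ Zhang2014.levelIndex W p n)
    (hne : d.kolyvaginClass hp.out M ≠ 0) :
    1 ≤ max (W.selmerCorank p) ((W.quadraticTwist (NumberField.discr K : ℚ)).selmerCorank p) ∧
      max (W.selmerCorank p) ((W.quadraticTwist (NumberField.discr K : ℚ)).selmerCorank p) ≤
        n.primeFactors.card + 1 := by
  obtain ⟨n₀, d₀, M₀, hn₀, hM₀, hM₀le, hne₀, hmin⟩ :=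
    heegnerSystem_exists_minimal_kolyvaginClass_ne_zero hp.out d hn hM hMle hne
  obtain ⟨hmax, -, -⟩ :=
    h.max_selmerCorank_eq W p hp5 hsurj K hK h3 h4 hpd hpN hH Dt β ι n₀ d₀ M₀ hn₀ hM₀ hM₀le hne₀ hmin
  have hle : n₀.primeFactors.card ≤ n.primeFactors.card := hmin n d M hn hM hMle hne
  omega

/-! ### 2. Depth zero: the bottom class and Kolyvagin's 1988 theorem -/

section DepthZero

variable {N : ℕ} [NeZero N] {W : WeierstrassCurve ℚ} [W.IsElliptic] {K : Type} [Field K]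
  [NumberField K] {Dt : ModularParametrizationData W N} {β : ℤ} {ι : K →+* ℂ}

/-- **A non-zero bottom class forces `corank_{ℤ_p} Sel_{p^∞}(E/ℚ) + corank_{ℤ_p} Sel_{p^∞}(E^{(d_K)}/ℚ) = 1`
for every prime `p`, by Kolyvagin's 1988 theorem** (Kolyvagin 1991, typescript p. 4: *"`f = 0 ⟺ P_1`
has infinite order"*, and p. 3: *"In my paper “Euler systems” I proved that `rank E(K) = 1` and
`Ш(K, E)` is finite when `P_1` has infinite order"*). Setting: `E/ℚ` elliptic (model `W`), `K`
imaginary quadratic with the Heegner hypothesis for `N`, a parametrisation datum `Dt` at level `N`,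
an orientation `β`, an embedding `ι`, a Kolyvagin–Heegner datum `d` of conductor `1`, and a class
`c_M(1) = d.kolyvaginClass hq M ≠ 0` for some prime `q` and level `M`. Granted the named facts
`kolyvagin N W K` (`hKo`: Kolyvagin 1990, Thm. A; Gross 1991, Thm. 1.3) and
`heegnerPointOfConductor_one_galoisConj N W K` (`hrec`: Shimura reciprocity at conductor `1`):
`P(1)` descends to a Heegner point `y_K ∈ E(K)`
(`heegnerSystem_exists_isHeegnerPoint_map_eq_derivedPoint_one`), which is non-torsion since a
torsion `P(1)` has vanishing class (`heegnerSystem_kolyvaginClass_eq_zero_of_isOfFinAddOrder`);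
so `rank E(K) = 1` and `Ш(E/K)` is finite (`hKo`), hence `corank_{ℤ_p} Sel_{p^∞}(E/K) = 1 + 0`
(`selmerCorank_eq_mordellWeilRank_add_holds`, `shaCorank_eq_zero_of_finite`) `= c + c'`
(`selmerCorank_baseChange_quadratic_holds`).
[cite: Kolyvagin1991MathAnn, §1 (typescript pp. 3–4: f = 0 iff P_1 of infinite order)]
[cite: Kolyvagin1990, Thm. A] [cite: GrossLMS1991, Thm. 1.3 and §4 (P_1 = y_K)] -/
theorem selmerCorank_add_eq_one_of_kolyvaginClass_one_ne_zero_of_kolyvagin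
    (hKo : kolyvagin N W K) (hrec : heegnerPointOfConductor_one_galoisConj N W K)
    (hK : IsImaginaryQuadratic K) (hH : SatisfiesHeegnerHypothesis N K)
    (d : KolyvaginHeegnerData Dt β ι 1) {q : ℕ} (hq : q.Prime) {M : ℕ}
    (hne : d.kolyvaginClass hq M ≠ 0) (p : ℕ) [Fact p.Prime] :
    W.selmerCorank p + (W.quadraticTwist (NumberField.discr K : ℚ)).selmerCorank p = 1 := by
  obtain ⟨P₀, hheeg, hP₀⟩ :=
    heegnerSystem_exists_isHeegnerPoint_map_eq_derivedPoint_one hrec hK hH d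
  have hnt : ¬ IsOfFinAddOrder P₀ := by
    intro htors
    apply hne
    refine heegnerSystem_kolyvaginClass_eq_zero_of_isOfFinAddOrder d hq M ?_
    rw [← hP₀]
    exact (WeierstrassCurve.Affine.Point.map (W' := W)
      (algebraMap K (ringClassField K ι 1)).toRatAlgHom).isOfFinAddOrder htors
  obtain ⟨hrank, hsha⟩ := hKo hK hH hheeg hnt
  haveI : Finite (W.baseChange K).sha := hsha
  have hcK : (W.baseChange K).selmerCorank p = 1 := by
    have h := (W.baseChange K).selmerCorank_eq_mordellWeilRank_add_holds p
    rw [hrank, (W.baseChange K).shaCorank_eq_zero_of_finite p, add_zero] at h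
    exact h
  rw [← selmerCorank_baseChange_quadratic_holds W K hK.1 p]
  exact hcK

/-- **The body of (K2) at conductor `n = 1` (depth `ν = 0`), from Kolyvagin's 1988 theorem.** At
`n = 1` the minimality hypothesis of `Kolyvagin1991_selmerCorank_of_kolyvaginClass_ne_zero` is
vacuous and its conclusion reads `(c = 1 ∧ c' ≤ 0 ∧ 2 ∣ 0 − c') ∨ (c' = 1 ∧ c ≤ 0 ∧ 2 ∣ 0 − c)`,
i.e. `c + c' = 1` (`selmerCorank_add_eq_one_of_kolyvaginClass_one_ne_zero_of_kolyvagin`); the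
remaining hypotheses of (K2) (`p ≥ 5`, `ρ̄_{E,p}` onto, `d_K ≠ −3, −4`, `p ∤ d_K N_E`, `1 ∈ Λ`,
`1 ≤ M ≤ M(1) = ∞`) are idle at this depth. So the depth-zero slice of Kolyvagin 1991, Thm. 4
(`r^{(1)} = 1`, `r^{(0)} ≤ 0` when `f = 0`) is, in the tree, a consequence of the named facts
`kolyvagin` and `heegnerPointOfConductor_one_galoisConj` and proved corank identities; depth
`ν ≥ 1` is not (module docstring).
[cite: Kolyvagin1991MathAnn, §2 Thm. 4 (case f = 0) with §1 (typescript pp. 3–4)]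
[cite: Kolyvagin1990, Thm. A] [cite: GrossLMS1991, Thm. 1.3] -/
theorem kolyvaginStructure_one_of_kolyvagin
    (hKo : kolyvagin N W K) (hrec : heegnerPointOfConductor_one_galoisConj N W K)
    (hK : IsImaginaryQuadratic K) (hH : SatisfiesHeegnerHypothesis N K)
    (d : KolyvaginHeegnerData Dt β ι 1) (p : ℕ) [hp : Fact p.Prime] {M : ℕ}
    (hne : d.kolyvaginClass hp.out M ≠ 0) :
    (W.selmerCorank p = (1 : ℕ).primeFactors.card + 1 ∧
        (W.quadraticTwist (NumberField.discr K : ℚ)).selmerCorank p ≤ (1 : ℕ).primeFactors.card ∧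
        Even ((1 : ℕ).primeFactors.card -
          (W.quadraticTwist (NumberField.discr K : ℚ)).selmerCorank p)) ∨
      ((W.quadraticTwist (NumberField.discr K : ℚ)).selmerCorank p = (1 : ℕ).primeFactors.card + 1 ∧
        W.selmerCorank p ≤ (1 : ℕ).primeFactors.card ∧
        Even ((1 : ℕ).primeFactors.card - W.selmerCorank p)) := by
  have h1 := selmerCorank_add_eq_one_of_kolyvaginClass_one_ne_zero_of_kolyvagin hKo hrec hK hH d
    hp.out hne p
  rw [Nat.primeFactors_one, Finset.card_empty]
  simp only [Nat.even_iff]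
  omega

end DepthZero

/-! ### 3. The parity clauses: `c + c'` is odd under the Heegner hypothesis -/

/-- **`corank_{ℤ_p} Sel_{p^∞}(E/ℚ) + corank_{ℤ_p} Sel_{p^∞}(E^{(d_K)}/ℚ)` is odd under the Heegner
hypothesis, from the `p`-parity theorem and the Modularity Theorem.** For `E/ℚ` elliptic, `p`
prime and `K` imaginary quadratic in which every prime dividing `N_E` splits:
`(−1)^c = w(E)` and `(−1)^{c'} = w(E^{(d_K)})` (Dokchitser–Dokchitser 2010, Thm. 1.4, the named
fact `p_parity`, hypothesis `hpar`), while `w(E) w(E^{(d_K)}) = −1` (Darmon 2004, Thm. 3.15: the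
sign of `L(E/K, s)`; tree theorem `rootNumber_mul_rootNumber_quadraticTwist_discr_of_exists_isNewformOf`
from `exists_isNewformOf`, hypothesis `hmod`); hence `(−1)^{c+c'} = −1`. This is Kolyvagin's
`r⁰ + r¹ ≡ g⁰ + g¹ ≡ 1 (mod 2)` (Thm. 2.4 with the sign of the functional equation over `K`),
obtained here from `p`-parity rather than from the structure theorem.
[cite: DokchitserDokchitserAnnals2010, Thm. 1.4] [cite: Darmon2004, §3.6 Thm. 3.15]
[cite: Kolyvagin1991MathAnn, §2 Thm. 2.4 (typescript p. 7)] -/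
theorem odd_selmerCorank_add_selmerCorank_quadraticTwist_of_p_parity
    (hpar : ∀ (W : WeierstrassCurve ℚ) [W.IsElliptic] (p : ℕ) [Fact p.Prime], p_parity W p)
    (hmod : exists_isNewformOf) (W : WeierstrassCurve ℚ) [W.IsElliptic] (p : ℕ) [Fact p.Prime]
    (K : Type u) [Field K] [NumberField K] (hK : IsImaginaryQuadratic K)
    (hH : SatisfiesHeegnerHypothesis (W.conductorNorm ℤ) K) :
    Odd (W.selmerCorank p + (W.quadraticTwist (NumberField.discr K : ℚ)).selmerCorank p) := by
  have hd : (NumberField.discr K : ℚ) ≠ 0 := by exact_mod_cast NumberField.discr_ne_zero K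
  haveI := W.isElliptic_quadraticTwist hd
  have hsign := rootNumber_mul_rootNumber_quadraticTwist_discr_of_exists_isNewformOf W K hmod hK hH
  have h1 : (-1 : ℤ) ^ W.selmerCorank p = W.rootNumber := hpar W p
  have h2 : (-1 : ℤ) ^ (W.quadraticTwist (NumberField.discr K : ℚ)).selmerCorank p =
      (W.quadraticTwist (NumberField.discr K : ℚ)).rootNumber :=
    hpar (W.quadraticTwist (NumberField.discr K : ℚ)) p
  rw [← h1, ← h2, ← pow_add] at hsign
  by_contra hodd
  rw [Nat.not_odd_iff_even] at hodd
  rw [hodd.neg_one_pow] at hsign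
  norm_num at hsign

/-- **The parity conjuncts of (K2) carry no debt beyond `p_parity` and `exists_isNewformOf`.** For
`E/ℚ` elliptic, `p` prime, `K` imaginary quadratic with the Heegner hypothesis for `N_E`, and any
`ν : ℕ`: the rank clauses `c = ν + 1 ∧ c' ≤ ν` or `c' = ν + 1 ∧ c ≤ ν` of Kolyvagin's theorem
already give its full conclusion `… ∧ 2 ∣ ν − c'`, resp. `… ∧ 2 ∣ ν − c`, because `c + c'` is odd
(`odd_selmerCorank_add_selmerCorank_quadraticTwist_of_p_parity`). Hence what the tree lacks of
(K2) is exactly the pair of rank clauses at depth `ν ≥ 1` (Kolyvagin 1991, Thms. 2–3).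
[cite: Kolyvagin1991MathAnn, §2 Thm. 4] [cite: DokchitserDokchitserAnnals2010, Thm. 1.4] -/
theorem kolyvaginStructure_alternative_of_rank_clauses_of_p_parity
    (hpar : ∀ (W : WeierstrassCurve ℚ) [W.IsElliptic] (p : ℕ) [Fact p.Prime], p_parity W p)
    (hmod : exists_isNewformOf) (W : WeierstrassCurve ℚ) [W.IsElliptic] (p : ℕ) [Fact p.Prime]
    (K : Type u) [Field K] [NumberField K] (hK : IsImaginaryQuadratic K)
    (hH : SatisfiesHeegnerHypothesis (W.conductorNorm ℤ) K) {ν : ℕ}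
    (h : (W.selmerCorank p = ν + 1 ∧ (W.quadraticTwist (NumberField.discr K : ℚ)).selmerCorank p ≤ ν) ∨
      ((W.quadraticTwist (NumberField.discr K : ℚ)).selmerCorank p = ν + 1 ∧ W.selmerCorank p ≤ ν)) :
    (W.selmerCorank p = ν + 1 ∧ (W.quadraticTwist (NumberField.discr K : ℚ)).selmerCorank p ≤ ν ∧
        Even (ν - (W.quadraticTwist (NumberField.discr K : ℚ)).selmerCorank p)) ∨
      ((W.quadraticTwist (NumberField.discr K : ℚ)).selmerCorank p = ν + 1 ∧ W.selmerCorank p ≤ ν ∧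
        Even (ν - W.selmerCorank p)) :=
  kolyvaginStructure_alternative_of_rank_clauses
    (odd_selmerCorank_add_selmerCorank_quadraticTwist_of_p_parity hpar hmod W p K hK hH) h

end Literature.NumberTheory.EllipticCurves

end
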